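import Summits.ABC.IUTFork.BrobergSlotResidue
import HarnessLib

/-!
# The (Ind1) slot residue of every genuine Θ-volume datum at Broberg's point, EXACTLY — part 2: the collection sums descend to `F` and
# re-ascend to `ℚ(√7)`; `slotResidue(T) = (11·log 3 + 4·log 47)/l · (1/ℓ⋆)·Σ_{i<ℓ⋆} (i+1)²·(½ − (½)^{i+2})`

Record-only PROOF file (D-0012; 0 def / 0 `Prop` fact / 0 instance / 0 notation) of the abc-iut cell (seat abc-iut-c312-d1, gen 12; rows
«C:PLACES-TRANSPORT-DMOD» → «C:UNION-PRINT-ISM-BROBERG», RULING (α)); sequel of `BrobergSlotResidue.lean` (§1 the point's field, §2 the pointwise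
transport `mu_finBelow_eq`). TAKES NO SIDE on [IUTchIII] Cor. 3.12.

* **`Broberg.innerSum_transport`** — for every genuine datum `T` at `(Broberg.point, l)`, every prime `p` and every procession index `i`, the
  collection sum `Σ_{v⃗ ∈ V(F_mod(E_F))_p^{i+2}} (θ_i(v⃗_{i+1}) − min_k θ_i(v⃗_k))·Π_k Pr(v⃗_k)` of abc-iut-S8's slot residue EQUALS the same sum over the
  collections of places of `ℚ(√7)` over `p` with `θ_i := (i+1)²·h_l` (both equal the `Pr_F`-expectation over collections of places of `F` of the common
  pull-back: abc-iut-S2's tuple weight descent `sum_prod_weight_mul_eq_of_fibreConst`, applied to `F_mod(E_F) ⊆ F` and to `ℚ(√7) ⊆ F`, whose fibres agree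
  by `Broberg.range_algebraMap_eq`);
* **`Broberg.slotResidue_singleton_three_eq`** / **`…_fortySeven_eq`** — the two-valued evaluation on `ℚ(√7)` (this lineage's
  `sum_last_sub_inf_mul_prod_weight_eq_of_twoValued`; over `3`: `Z = {𝔭₃'}`, `a − b = (12 − 1)·log 3/l·(i+1)²`, `ω = ½`; over `47`: `Z = {𝔭₄₇}`,
  `a = 4·log 47/l·(i+1)²`, `b = 0`, `ω = ½`);
* **`Broberg.slotResidue_eq`** — support canonicity (abc-iut-S8 `slotResidue_eq_of_support`: the datum's bad primes of `F_mod` lie over `3, 47` only)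
  and additivity: `slotResidue(T.I.X, T(I)) = (11·log 3 + 4·log 47)/l · (1/ℓ⋆)·Σ_{i<ℓ⋆} (i+1)²·(½ − (½)^{i+2})` for EVERY `T : ThetaVolumeDatumAt Broberg.point l`,
  `l` prime, `l ∉ {3, 47}` (the datum forces `l ≥ 5`, so `l ≠ 2`).

HONEST SCOPE: classical bookkeeping of OUR typed data; no datum constructed, non-emptiness not claimed; nothing here bears on [IUTchIII] Cor. 3.12
or asserts abc; no side taken. [cite: DupuyHilado2025, §3.3, §3.6, §4.7] [cite: Mochizuki2012, IUTchIV Thm. 1.10 Step (v) p. 27–28; Cor. 2.2 (ii)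
proof (P5) p. 46] [cite: NeukirchANT1999, Ch. I §8 Prop. (8.2)] [claim: Mochizuki2012, status: disputed] for every IUT quotation.
-/

noncomputable section

open scoped Classical NumberField

open NumberField IsDedekindDomain

namespace Summit.ABC.IUTFork.Broberg

open Sqrt7 Literature.IUT.LogVolume Literature.IUT.LogVolume.Cor22 Literature.IUT.HodgeTheaters
  Literature.NumberTheory.DiophantineGeometry.GenEll

/-! ## §3. The collection sums descend to `F` and re-ascend to `ℚ(√7)` -/

/-- **Transport of the collection sums of the slot residue** (see the module docstring). [cite: DupuyHilado2025, §3.6, §4.7]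
[cite: Mochizuki2012, IUTchIV Thm. 1.10 Step (v) p. 27–28] [claim: Mochizuki2012, status: disputed] -/
theorem innerSum_transport {l : ℕ} (T : ThetaVolumeDatumAt point l) (p : ℕ) [Fact p.Prime] :
    (letI := T.instFieldF; letI := T.instNumberFieldF; letI := T.instAlgebraF; letI := T.instFieldK
     letI := T.instNumberFieldK; letI := T.instAlgebraK; letI := T.instFieldFbar; letI := T.instAlgebraFbar
     letI := T.instAlgebraKFbar; letI := T.instIsElliptic
     ∀ i : Fin T.I.X.lstar,
       ∑ e : Fin ((i : ℕ) + 1 + 1) → placesOver ↥(fieldOfModuli T.E) p,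
          (T.I.X.slotValue i (e (Fin.last _)).1
            - Finset.univ.inf' Finset.univ_nonempty (fun k => T.I.X.slotValue i (e k).1)) *
            ∏ k, weight ↥(fieldOfModuli T.E) (e k).1 =
       ∑ V : Fin ((i : ℕ) + 1 + 1) → placesOver point.F p,
          ((((i : ℕ) + 1 : ℝ) ^ 2) *
              (if (V (Fin.last _)).1 ∈ badPlacesAvoid point {2, l} then
                -(1 / (2 * (l : ℝ))) * ((ord point.F (V (Fin.last _)).1 (jInv point.x) : ℝ) *
                  logNorm point.F (V (Fin.last _)).1 / (localDegree point.F (V (Fin.last _)).1 : ℝ))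
               else 0)
            - Finset.univ.inf' Finset.univ_nonempty (fun k => (((i : ℕ) + 1 : ℝ) ^ 2) *
              (if (V k).1 ∈ badPlacesAvoid point {2, l} then
                -(1 / (2 * (l : ℝ))) * ((ord point.F (V k).1 (jInv point.x) : ℝ) *
                  logNorm point.F (V k).1 / (localDegree point.F (V k).1 : ℝ))
               else 0))) *
            ∏ k, weight point.F (V k).1) := by
  letI := T.instFieldF; letI := T.instNumberFieldF; letI := T.instAlgebraF; letI := T.instFieldK
  letI := T.instNumberFieldK; letI := T.instAlgebraK; letI := T.instFieldFbar; letI := T.instAlgebraFbar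
  letI := T.instAlgebraKFbar; letI := T.instIsElliptic
  intro i
  set FE : Type := ↥(fieldOfModuli T.E) with hFE
  set m : ℕ := (i : ℕ) + 1 with hm
  -- the two point functions: the datum's `θ_i` on places of `F_mod(E_F)`, and `(i+1)²·h_l` on places of `ℚ(√7)`
  set θE : HeightOneSpectrum (𝓞 FE) → ℝ := fun u => T.I.X.slotValue i u with hθE
  set θK : HeightOneSpectrum (𝓞 point.F) → ℝ := fun W => (((i : ℕ) + 1 : ℝ) ^ 2) *
    (if W ∈ badPlacesAvoid point {2, l} then
      -(1 / (2 * (l : ℝ))) * ((ord point.F W (jInv point.x) : ℝ) * logNorm point.F W / (localDegree point.F W : ℝ))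
     else 0) with hθK
  -- the collection functionals
  set Φ : (Fin (m + 1) → HeightOneSpectrum (𝓞 FE)) → ℝ := fun u =>
    θE (u (Fin.last m)) - Finset.univ.inf' Finset.univ_nonempty (fun k => θE (u k)) with hΦ
  set Ψ : (Fin (m + 1) → HeightOneSpectrum (𝓞 point.F)) → ℝ := fun u =>
    θK (u (Fin.last m)) - Finset.univ.inf' Finset.univ_nonempty (fun k => θK (u k)) with hΨ
  -- pointwise agreement through a place of `F`
  have hpt : ∀ x : HeightOneSpectrum (𝓞 T.F), θE (finBelow FE T.F x) = θK (finBelow point.F T.F x) := by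
    intro x
    simp only [hθE, hθK]
    rw [PilotData.slotValue_eq_sq_mul, mu_finBelow_eq T x]
  -- sections and the pulled-back functionals on collections of places of `F`
  obtain ⟨sE, hsE⟩ := exists_section_placesOver FE T.F p
  obtain ⟨sK, hsK⟩ := exists_section_placesOver point.F T.F p
  set q : (Fin (m + 1) → placesOver T.F p) → ℝ := fun w => Φ (fun k => finBelow FE T.F (w k).1) with hq
  set q' : (Fin (m + 1) → placesOver T.F p) → ℝ := fun w => Ψ (fun k => finBelow point.F T.F (w k).1) with hq'
  have hqc : ∀ w w' : Fin (m + 1) → placesOver T.F p,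
      (∀ a, finBelow FE T.F (w a).1 = finBelow FE T.F (w' a).1) → q w = q w' :=
    fun w w' h => congrArg Φ (funext fun k => h k)
  have hqc' : ∀ w w' : Fin (m + 1) → placesOver T.F p,
      (∀ a, finBelow point.F T.F (w a).1 = finBelow point.F T.F (w' a).1) → q' w = q' w' :=
    fun w w' h => congrArg Ψ (funext fun k => h k)
  have hqq : q = q' := by
    funext w
    simp only [hq, hq', hΦ, hΨ, hpt]
  have hdescE := sum_prod_weight_mul_eq_of_fibreConst FE T.F q sE hsE hqc
  have hdescK := sum_prod_weight_mul_eq_of_fibreConst point.F T.F q' sK hsK hqc'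
  have hqE : ∀ v : Fin (m + 1) → placesOver FE p, q (fun a => sE (v a)) = Φ (fun k => (v k).1) :=
    fun v => congrArg Φ (funext fun k => hsE (v k))
  have hqK : ∀ V : Fin (m + 1) → placesOver point.F p, q' (fun a => sK (V a)) = Ψ (fun k => (V k).1) :=
    fun V => congrArg Ψ (funext fun k => hsK (V k))
  calc ∑ e : Fin (m + 1) → placesOver FE p,
        (T.I.X.slotValue i (e (Fin.last _)).1 - Finset.univ.inf' Finset.univ_nonempty (fun k => T.I.X.slotValue i (e k).1)) *
          ∏ k, weight FE (e k).1
      = ∑ v : Fin (m + 1) → placesOver FE p, (∏ a, weight FE (v a).1) * q (fun a => sE (v a)) := by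
        refine Finset.sum_congr rfl fun v _ => ?_
        rw [hqE, mul_comm]
    _ = ∑ w : Fin (m + 1) → placesOver T.F p, (∏ a, weight T.F (w a).1) * q w := hdescE.symm
    _ = ∑ w : Fin (m + 1) → placesOver T.F p, (∏ a, weight T.F (w a).1) * q' w := by rw [hqq]
    _ = ∑ V : Fin (m + 1) → placesOver point.F p, (∏ a, weight point.F (V a).1) * q' (fun a => sK (V a)) := hdescK
    _ = _ := by
        refine Finset.sum_congr rfl fun V _ => ?_
        rw [hqK, mul_comm]

/-! ## §4. The two-valued evaluation on `ℚ(√7)`: the residue at `3` and at `47` -/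

/-- **`slotResidue(T.I.X, {3}) = 11·log 3/l · (1/ℓ⋆)·Σ_{i<ℓ⋆} (i+1)²·(½ − (½)^{i+2})`** for every genuine datum at `(Broberg.point, l)`, `l` prime,
`l ∉ {3, 47}` (`V(K)_3 = {𝔭₃, 𝔭₃'}`, weights `½`, `h_l = log 3/l | 12·log 3/l`). [cite: DupuyHilado2025, §4.7]
[cite: Mochizuki2012, IUTchIV Thm. 1.10 Step (v) p. 27–28] [claim: Mochizuki2012, status: disputed] -/
theorem slotResidue_singleton_three_eq {l : ℕ} (hl : l.Prime) (h3 : l ≠ 3) (h47 : l ≠ 47) (T : ThetaVolumeDatumAt point l) :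
    (letI := T.instFieldF; letI := T.instNumberFieldF; letI := T.instAlgebraF; letI := T.instFieldK
     letI := T.instNumberFieldK; letI := T.instAlgebraK; letI := T.instFieldFbar; letI := T.instAlgebraFbar
     letI := T.instAlgebraKFbar; letI := T.instIsElliptic
     T.I.X.slotResidue {3} =
       (11 * Real.log 3 / l) * ((1 / (T.I.X.lstar : ℝ)) * ∑ i : Fin T.I.X.lstar,
          (((i : ℕ) + 1 : ℝ) ^ 2) * (1 / 2 - (1 / 2 : ℝ) ^ ((i : ℕ) + 2)))) := by
  letI := T.instFieldF; letI := T.instNumberFieldF; letI := T.instAlgebraF; letI := T.instFieldK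
  letI := T.instNumberFieldK; letI := T.instAlgebraK; letI := T.instFieldFbar; letI := T.instAlgebraFbar
  letI := T.instAlgebraKFbar; letI := T.instIsElliptic
  haveI : Fact (Nat.Prime 3) := ⟨Nat.prime_three⟩
  obtain ⟨V, V', hV, hV'⟩ : ∃ V V' : HeightOneSpectrum (𝓞 point.F), V = 𝔭₃ ∧ V' = 𝔭₃' := ⟨_, _, rfl, rfl⟩
  obtain ⟨hwV, hwV', henum⟩ := weight_three V V' hV hV'
  have hV'mem : V' ∈ placesOver point.F 3 := mem_placesOver_of_natCast_mem 3 V' (by rw [hV']; exact_mod_cast three_mem_𝔭₃')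
  have hne : V ≠ V' := by rw [hV, hV']; exact 𝔭₃_ne_𝔭₃'
  have hvals := badHeight_values hl h3 h47
  have hl0 : (0 : ℝ) < l := by exact_mod_cast hl.pos
  have hlog3 : (0 : ℝ) ≤ Real.log 3 := Real.log_nonneg (by norm_num)
  rw [T.I.X.slotResidue_singleton_eq_sum 3, Finset.mul_sum, Finset.mul_sum, Finset.mul_sum]
  refine Finset.sum_congr rfl fun i _ => ?_
  rw [innerSum_transport T 3 i]
  -- the two-valued identity on `V(K)_3` with `Z = {𝔭₃'}`
  have key := PilotData.sum_last_sub_inf_mul_prod_weight_eq_of_twoValued (S := placesOver point.F 3)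
    (fun W => weight point.F W.1) (PilotData.sum_weight_placesOver (F := point.F) 3) {⟨V', hV'mem⟩}
    (fun W => (((i : ℕ) + 1 : ℝ) ^ 2) *
      (if W.1 ∈ badPlacesAvoid point {2, l} then
        -(1 / (2 * (l : ℝ))) * ((ord point.F W.1 (jInv point.x) : ℝ) * logNorm point.F W.1 / (localDegree point.F W.1 : ℝ))
       else 0))
    (a := (((i : ℕ) + 1 : ℝ) ^ 2) * (12 * Real.log 3 / l)) (b := (((i : ℕ) + 1 : ℝ) ^ 2) * (Real.log 3 / l))
    (mul_le_mul_of_nonneg_left (by rw [div_le_div_iff_of_pos_right hl0]; linarith) (sq_nonneg _))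
    (fun W hW => by
      rw [Finset.mem_singleton] at hW
      rw [hvals.2.1 W.1 (by rw [hW]; exact hV')])
    (fun W hW => by
      rw [Finset.mem_singleton] at hW
      have hW1 : W.1 = V := by
        rcases henum W.1 W.2 with h | h
        · exact h
        · exact absurd (Subtype.ext h) hW
      rw [hvals.1 W.1 (hW1.trans hV)])
    ((i : ℕ) + 1)
  rw [Finset.sum_singleton] at key
  rw [key, hwV']
  ring

/-- **`slotResidue(T.I.X, {47}) = 4·log 47/l · (1/ℓ⋆)·Σ_{i<ℓ⋆} (i+1)²·(½ − (½)^{i+2})`** for every genuine datum at `(Broberg.point, l)`, `l` prime,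
`l ∉ {3, 47}` (`Pr(𝔭₄₇) = ½`, `h_l(𝔭₄₇) = 4·log 47/l`, `h_l = 0` at the other place over `47`). [cite: DupuyHilado2025, §4.7]
[cite: Mochizuki2012, IUTchIV Thm. 1.10 Step (v) p. 27–28] [claim: Mochizuki2012, status: disputed] -/
theorem slotResidue_singleton_fortySeven_eq {l : ℕ} (hl : l.Prime) (h3 : l ≠ 3) (h47 : l ≠ 47) (T : ThetaVolumeDatumAt point l) :
    (letI := T.instFieldF; letI := T.instNumberFieldF; letI := T.instAlgebraF; letI := T.instFieldK
     letI := T.instNumberFieldK; letI := T.instAlgebraK; letI := T.instFieldFbar; letI := T.instAlgebraFbar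
     letI := T.instAlgebraKFbar; letI := T.instIsElliptic
     T.I.X.slotResidue {47} =
       (4 * Real.log 47 / l) * ((1 / (T.I.X.lstar : ℝ)) * ∑ i : Fin T.I.X.lstar,
          (((i : ℕ) + 1 : ℝ) ^ 2) * (1 / 2 - (1 / 2 : ℝ) ^ ((i : ℕ) + 2)))) := by
  letI := T.instFieldF; letI := T.instNumberFieldF; letI := T.instAlgebraF; letI := T.instFieldK
  letI := T.instNumberFieldK; letI := T.instAlgebraK; letI := T.instFieldFbar; letI := T.instAlgebraFbar
  letI := T.instAlgebraKFbar; letI := T.instIsElliptic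
  haveI : Fact (Nat.Prime 47) := ⟨by norm_num⟩
  obtain ⟨V, V', hV, hV'⟩ : ∃ V V' : HeightOneSpectrum (𝓞 point.F), V = 𝔭₄₇ ∧ V' = 𝔭₄₇' := ⟨_, _, rfl, rfl⟩
  obtain ⟨hwV, hwV', henum⟩ := weight_fortySeven V V' hV hV'
  have hVmem : V ∈ placesOver point.F 47 := mem_placesOver_of_natCast_mem 47 V (by rw [hV]; exact_mod_cast fortySeven_mem_𝔭₄₇)
  have hvals := badHeight_values hl h3 h47
  have hl0 : (0 : ℝ) < l := by exact_mod_cast hl.pos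
  have hlog47 : (0 : ℝ) ≤ Real.log 47 := Real.log_nonneg (by norm_num)
  rw [T.I.X.slotResidue_singleton_eq_sum 47, Finset.mul_sum, Finset.mul_sum, Finset.mul_sum]
  refine Finset.sum_congr rfl fun i _ => ?_
  rw [innerSum_transport T 47 i]
  have key := PilotData.sum_last_sub_inf_mul_prod_weight_eq_of_twoValued (S := placesOver point.F 47)
    (fun W => weight point.F W.1) (PilotData.sum_weight_placesOver (F := point.F) 47) {⟨V, hVmem⟩}
    (fun W => (((i : ℕ) + 1 : ℝ) ^ 2) *
      (if W.1 ∈ badPlacesAvoid point {2, l} then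
        -(1 / (2 * (l : ℝ))) * ((ord point.F W.1 (jInv point.x) : ℝ) * logNorm point.F W.1 / (localDegree point.F W.1 : ℝ))
       else 0))
    (a := (((i : ℕ) + 1 : ℝ) ^ 2) * (4 * Real.log 47 / l)) (b := (((i : ℕ) + 1 : ℝ) ^ 2) * 0)
    (mul_le_mul_of_nonneg_left (by positivity) (sq_nonneg _))
    (fun W hW => by
      rw [Finset.mem_singleton] at hW
      rw [hvals.2.2 W.1 (by rw [hW]; exact hV)])
    (fun W hW => by
      rw [Finset.mem_singleton] at hW
      have hW1 : W.1 ≠ 𝔭₄₇ := fun h => hW (Subtype.ext (h.trans hV.symm))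
      rw [badHeight_eq_zero_of_ne_𝔭₄₇ W.1 W.2 hW1])
    ((i : ℕ) + 1)
  rw [Finset.sum_singleton] at key
  rw [key, hwV]
  ring

/-! ## §5. Support canonicity and the exact residue -/

/-- **The datum's bad primes of `F_mod(E_F)` lie over `3` and `47` only** (through a place of `F` above: badness on `ℚ(√7)` by
`PointDict.under_mem_badPrimesMod_iff`, and `𝕍^bad(ℚ(√7)) = {𝔭₃, 𝔭₃', 𝔭₄₇}`, abc-iut-W-row-2 / abc-iut-C-cert-2 `Broberg.mem_badPlaces_iff`).
[cite: Mochizuki2012, IUTchIV Cor. 2.2 (ii) proof (P5) p. 46] [claim: Mochizuki2012, status: disputed] -/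
theorem residueChar_mem_pair_of_mem_S {l : ℕ} (T : ThetaVolumeDatumAt point l) :
    (letI := T.instFieldF; letI := T.instNumberFieldF; letI := T.instAlgebraF; letI := T.instFieldK
     letI := T.instNumberFieldK; letI := T.instAlgebraK; letI := T.instFieldFbar; letI := T.instAlgebraFbar
     letI := T.instAlgebraKFbar; letI := T.instIsElliptic
     ∀ v ∈ T.I.X.S, residueChar ↥(fieldOfModuli T.E) v ∈ ({3, 47} : Finset ℕ)) := by
  letI := T.instFieldF; letI := T.instNumberFieldF; letI := T.instAlgebraF; letI := T.instFieldK
  letI := T.instNumberFieldK; letI := T.instAlgebraK; letI := T.instFieldFbar; letI := T.instAlgebraFbar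
  letI := T.instAlgebraKFbar; letI := T.instIsElliptic
  haveI : Fact (Nat.Prime 3) := ⟨Nat.prime_three⟩
  haveI : Fact (Nat.Prime 47) := ⟨by norm_num⟩
  set FE : Type := ↥(fieldOfModuli T.E) with hFE
  intro v hv
  have hvbad : v ∈ ThetaData.badPrimesMod T.D := by rw [← (PointDict.X_S_eq T).1]; exact hv
  obtain ⟨y, hy⟩ := PlaceSection.exists_under_eq (F₀ := FE) (K := T.F) v
  have hW : finBelow point.F T.F y ∈ badPlacesAvoid point {2, l} :=
    (PointDict.under_mem_badPrimesMod_iff T y).mp (by rw [hy]; exact hvbad)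
  have hWbad : finBelow point.F T.F y ∈ badPlaces point := (Finset.mem_filter.mp hW).1
  have hres : residueChar FE v = residueChar point.F (finBelow point.F T.F y) := by
    rw [residueChar_finBelow, ← hy]
    exact (residueChar_finBelow (F := FE) (K := T.F) y).symm
  rw [hres]
  rcases (mem_badPlaces_iff _).mp hWbad with h | h | h
  · have hm : finBelow point.F T.F y ∈ placesOver point.F 3 :=
      mem_placesOver_of_natCast_mem 3 _ (by rw [h]; exact_mod_cast three_mem_𝔭₃)
    rw [(mem_placesOver_iff_residueChar _).mp hm]; decide
  · have hm : finBelow point.F T.F y ∈ placesOver point.F 3 :=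
      mem_placesOver_of_natCast_mem 3 _ (by rw [h]; exact_mod_cast three_mem_𝔭₃')
    rw [(mem_placesOver_iff_residueChar _).mp hm]; decide
  · have hm : finBelow point.F T.F y ∈ placesOver point.F 47 :=
      mem_placesOver_of_natCast_mem 47 _ (by rw [h]; exact_mod_cast fortySeven_mem_𝔭₄₇)
    rw [(mem_placesOver_iff_residueChar _).mp hm]; decide

/-- **THE EXACT (Ind1) SLOT RESIDUE AT BROBERG'S POINT**: for every prime `l ∉ {3, 47}` and EVERY genuine Θ-volume datum `T` at `(Broberg.point, l)`,
`slotResidue(T.I.X, T(I)) = (11·log 3 + 4·log 47)/l · (1/ℓ⋆)·Σ_{i<ℓ⋆} (i+1)²·(½ − (½)^{i+2})` (support canonicity, abc-iut-S8 `slotResidue_eq_of_support`;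
additivity `slotResidue_eq_sum_singleton`, abc-iut-s2-p2; §4). [cite: DupuyHilado2025, §4.7] [cite: Mochizuki2012, IUTchIV Thm. 1.10 Step (v) p. 27–28]
[claim: Mochizuki2012, status: disputed] -/
theorem slotResidue_eq {l : ℕ} (hl : l.Prime) (h3 : l ≠ 3) (h47 : l ≠ 47) (T : ThetaVolumeDatumAt point l) :
    (letI := T.instFieldF; letI := T.instNumberFieldF; letI := T.instAlgebraF; letI := T.instFieldK
     letI := T.instNumberFieldK; letI := T.instAlgebraK; letI := T.instFieldFbar; letI := T.instAlgebraFbar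
     letI := T.instAlgebraKFbar; letI := T.instIsElliptic
     T.I.X.slotResidue T.I.supportPrimes =
       ((11 * Real.log 3 + 4 * Real.log 47) / l) * ((1 / (T.I.X.lstar : ℝ)) * ∑ i : Fin T.I.X.lstar,
          (((i : ℕ) + 1 : ℝ) ^ 2) * (1 / 2 - (1 / 2 : ℝ) ^ ((i : ℕ) + 2)))) := by
  letI := T.instFieldF; letI := T.instNumberFieldF; letI := T.instAlgebraF; letI := T.instFieldK
  letI := T.instNumberFieldK; letI := T.instAlgebraK; letI := T.instFieldFbar; letI := T.instAlgebraFbar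
  letI := T.instAlgebraKFbar; letI := T.instIsElliptic
  have hsupp : T.I.X.slotResidue T.I.supportPrimes = T.I.X.slotResidue {3, 47} :=
    T.I.X.slotResidue_eq_of_support (fun p hp => T.I.prime_of_mem_supportPrimes hp)
      (fun p hp => by
        simp only [Finset.mem_insert, Finset.mem_singleton] at hp
        rcases hp with rfl | rfl <;> norm_num)
      (fun v hv => T.I.residueChar_mem_supportPrimes hv) (residueChar_mem_pair_of_mem_S T)
  rw [hsupp, T.I.X.slotResidue_eq_sum_singleton, Finset.sum_pair (by norm_num),
    slotResidue_singleton_three_eq hl h3 h47 T, slotResidue_singleton_fortySeven_eq hl h3 h47 T]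
  ring

end Summit.ABC.IUTFork.Broberg

end
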